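/-
HONEST FRAMING: certified error envelopes and provably optimal rounding/accumulation schemes for
low-precision formats under stated cost models; every table by two implementations; no hardware
or vendor claims.
-/
import Summits.Ventures.CertifiedArithmetic.LowPrec.OptDemotionRoutingConeQ5CertA
import Summits.Ventures.CertifiedArithmetic.LowPrec.OptDemotionRoutingConeQ5CertB
import Summits.Ventures.CertifiedArithmetic.LowPrec.OptDemotionRoutingConeQ5CertC
import Summits.Ventures.CertifiedArithmetic.LowPrec.OptDemotionRoutingConeQ5CertD
import Summits.Ventures.CertifiedArithmetic.LowPrec.OptDemotionRoutingConeQ5CertE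
import Summits.Ventures.CertifiedArithmetic.LowPrec.OptDemotionRoutingConeQ5CertF
import Summits.Ventures.CertifiedArithmetic.LowPrec.OptDemotionRoutingConeQ5CertG
import Summits.Ventures.CertifiedArithmetic.LowPrec.OptDemotionRoutingConeQ5CertH
import Summits.Ventures.CertifiedArithmetic.LowPrec.OptDemotionRoutingConeQ5CertI
import Summits.Ventures.CertifiedArithmetic.LowPrec.OptDemotionRoutingConeQ5CertJ
import Summits.Ventures.CertifiedArithmetic.LowPrec.OptDemotionRoutingConeQ5CertK
import Summits.Ventures.CertifiedArithmetic.LowPrec.OptDemotionRoutingConeQ5CertL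
import Summits.Ventures.CertifiedArithmetic.LowPrec.OptDemotionRoutingConeQ5CertM
import Summits.Ventures.CertifiedArithmetic.LowPrec.OptDemotionRoutingConeQ5CertN
import Summits.Ventures.CertifiedArithmetic.LowPrec.OptDemotionRoutingConeQ5CertO
import Summits.Ventures.CertifiedArithmetic.LowPrec.OptDemotionRoutingConeQ5CertP

/-!
# The demotion law (Theorem T8), part 9f (Q5): `TT 5` AND CONJECTURE D FOR EVERY TREE AT q = 5

Assembly of the kernel-checked cone-closure certificate at `q = 5` (opt gen 14 C37,
`certs/opt/closure_q5_min.json`; parts 9a–9e): every row of `coneRowsQ5` has a passing certificate tree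
(`coneRowsQ5_covered`), so by the cone-closure principle (part 9c) the routing table of EVERY
summation tree lies in the cone (`tab_inCone_q5`), whose `O`/`E` rows give opt's two-tree
inequality **`TT 5`** (`TT_five`; part 8l — until now certified numerically, C33), hence by
part 8n `conjectureD_of_TT` **CONJECTURE D `s ≤ Q_t · fl_p(ŝ)` FOR EVERY SUMMATION TREE at
precision q = 5**, every `p ≥ 1`, any nearest roundings, nonnegative data (`conjectureD_q5`), and
the routing conjecture `W = BR` for every shape at `q = 5` (`routingBound_q5`). The
multipliers are NOT opt's: each of the 4234 leaf LPs was re-solved exactly (opt gen14 `lib/lpdual.py`, weighted-ℓ1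
dual objective; lean seat kit job j134528, `code/lean/cone_g12`) and the smaller of the two certificates kept per leaf
(237 581 digits of multipliers in 16 files instead of 391 983 in 27); rows, split data and weights are unchanged.
-/

namespace Summit.Ventures.CertifiedArithmetic.LowPrec.Opt

open Literature.ComputerArithmetic.JeannerodRump2018
open Literature.ComputerArithmetic.JeannerodRump2018.SumTree
open Cone

/-- Every row of `coneRowsQ5` has a passing certificate tree. -/
theorem coneRowsQ5_covered : RowsCovered 5 coneRowsQ5 conePartsQ5 232 := by
  have c0 : RowsCovered 5 coneRowsQ5 conePartsQ5 0 := rowsCovered_zero _ _ _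
  have c1 : RowsCovered 5 coneRowsQ5 conePartsQ5 27 := c0.extend coneCertQ5A_check
  have c2 : RowsCovered 5 coneRowsQ5 conePartsQ5 46 := c1.extend coneCertQ5B_check
  have c3 : RowsCovered 5 coneRowsQ5 conePartsQ5 51 := c2.extend coneCertQ5C_check
  have c4 : RowsCovered 5 coneRowsQ5 conePartsQ5 68 := c3.extend coneCertQ5D_check
  have c5 : RowsCovered 5 coneRowsQ5 conePartsQ5 81 := c4.extend coneCertQ5E_check
  have c6 : RowsCovered 5 coneRowsQ5 conePartsQ5 90 := c5.extend coneCertQ5F_check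
  have c7 : RowsCovered 5 coneRowsQ5 conePartsQ5 94 := c6.extend coneCertQ5G_check
  have c8 : RowsCovered 5 coneRowsQ5 conePartsQ5 96 := c7.extend coneCertQ5H_check
  have c9 : RowsCovered 5 coneRowsQ5 conePartsQ5 105 := c8.extend coneCertQ5I_check
  have c10 : RowsCovered 5 coneRowsQ5 conePartsQ5 117 := c9.extend coneCertQ5J_check
  have c11 : RowsCovered 5 coneRowsQ5 conePartsQ5 127 := c10.extend coneCertQ5K_check
  have c12 : RowsCovered 5 coneRowsQ5 conePartsQ5 136 := c11.extend coneCertQ5L_check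
  have c13 : RowsCovered 5 coneRowsQ5 conePartsQ5 146 := c12.extend coneCertQ5M_check
  have c14 : RowsCovered 5 coneRowsQ5 conePartsQ5 198 := c13.extend coneCertQ5N_check
  have c15 : RowsCovered 5 coneRowsQ5 conePartsQ5 221 := c14.extend coneCertQ5O_check
  have c16 : RowsCovered 5 coneRowsQ5 conePartsQ5 232 := c15.extend coneCertQ5P_check
  exact c16

/-- The routing table of every summation tree lies in the cone of `coneRowsQ5`. -/
theorem tab_inCone_q5 (t : SumTree) : InCone coneRowsQ5 (tab 5 t) :=
  tab_inCone (by norm_num) conePartsQ5_valid (coneRowsQ5_covered.all coneRowsQ5_length) t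

/-- **opt's TWO-TREE INEQUALITY AT q = 5** (part 8l `TT`), by the cone-closure certificate. -/
theorem TT_five : TT 5 := TT_of_checks coneRowsQ5_tt tab_inCone_q5

/-- **THE ROUTING CONJECTURE `W = BR` FOR EVERY SHAPE AT q = 5** (part 8e `RoutingBound`). -/
theorem routingBound_q5 (s : Shape) : RoutingBound 5 s :=
  routingBound_of_TT (by norm_num) TT_five s

/-- **CONJECTURE D FOR EVERY SUMMATION TREE AT PRECISION q = 5** (OPTIMA T8(b)(iii)): for every
`p ≥ 1`, any nearest roundings `fl` into `F(5, emin)` and `flp` into `F(p, emin)`, and every summation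
tree `t` of nonnegative `F(5, emin)` data, `s ≤ Q_t(u_5, u_p) · fl_p(ŝ)`. -/
theorem conjectureD_q5 {p : ℕ} (hp : 1 ≤ p) {emin : ℤ} {fl flp : ℚ → ℚ} (hfl : IsRoundNearest 5 emin fl)
    (hflp : IsRoundNearest p emin flp) (t : SumTree) (ht : ∀ x ∈ leaves t, IsFloat 5 emin x ∧ 0 ≤ x) :
    exact t ≤ treeQf (unitRoundoff 5) t (unitRoundoff p) * flp (eval fl t) :=
  conjectureD_of_TT hp (by norm_num) TT_five hfl hflp t ht

end Summit.Ventures.CertifiedArithmetic.LowPrec.Opt
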